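import Literature.Computability.AlgebraicComplexity.SymmetricArithCircuit
import Mathlib.Tactic.DeriveFintype
import HarnessLib

/-!
# The naive `S_n`-symmetric circuit for the matrix product

Companion of `Literature.Computability.AlgebraicComplexity.SymmetricArithCircuit` (Dawar–Wilsenach
symmetric arithmetic circuits, definition request `defn-SymmetricArithmeticCircuit` of route
`MatrixMultiplication/PriceOfSymmetry`): the textbook circuit with inputs `A_ij`, `B_jk`, product
gates `A_ij × B_jk` and sum gates `Σ_j A_ij B_jk`, on which `S_n` acts by relabelling indices, is a
`SymmetricArithmeticCircuit (Equiv.Perm (Fin n))` of size `n³ + 3n²` computing the `n × n` matrix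
product, and its gates have supports of size `≤ 3`. This shows the notion is inhabited and that the
cubic lower bound sought by the route (crux `SymmetricCircuitsCubic`) would be tight. Everything is
proved; folklore.
-/

noncomputable section

namespace Literature.Computability.AlgebraicComplexity

open MvPolynomial

universe u

section MatMul

variable (n : ℕ)
/-! ### The naive `S_n`-symmetric circuit for the matrix product (non-vacuity, `O(n³)` upper bound) -/

/-- Gates of the naive matrix-product circuit: the `2n²` inputs, the `n³` products
`p_ijk = A_ij × B_jk` and the `n²` sums `s_ik = Σ_j p_ijk`. [folklore] -/
inductive NaiveMatMulGate (n : ℕ) : Type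
  /-- Input gate for the variable `x`. -/
  | inp (x : MatMulVar n) : NaiveMatMulGate n
  /-- Product gate `A_ij × B_jk`. -/
  | prd (i j k : Fin n) : NaiveMatMulGate n
  /-- Sum gate `Σ_j A_ij B_jk` (the output `(i, k)`). -/
  | out (i k : Fin n) : NaiveMatMulGate n
  deriving DecidableEq, Fintype

namespace NaiveMatMulGate

variable {n}

/-- `S_n` acts on the gates by relabelling all indices. [folklore] -/
instance instMulAction : MulAction (Equiv.Perm (Fin n)) (NaiveMatMulGate n) where
  smul σ
    | inp x => inp (σ • x)
    | prd i j k => prd (σ i) (σ j) (σ k)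
    | out i k => out (σ i) (σ k)
  one_smul g := by
    cases g with
    | inp x => exact congrArg inp (one_smul _ x)
    | prd i j k => rfl
    | out i k => rfl
  mul_smul σ τ g := by
    cases g with
    | inp x => exact congrArg inp (mul_smul σ τ x)
    | prd i j k => rfl
    | out i k => rfl

/-- The action on input gates. [folklore] -/
@[simp] theorem smul_inp (σ : Equiv.Perm (Fin n)) (x : MatMulVar n) : σ • inp x = inp (σ • x) := rfl

/-- The action on product gates. [folklore] -/
@[simp] theorem smul_prd (σ : Equiv.Perm (Fin n)) (i j k : Fin n) :
    σ • prd i j k = prd (σ i) (σ j) (σ k) := rfl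

/-- The action on sum gates. [folklore] -/
@[simp] theorem smul_out (σ : Equiv.Perm (Fin n)) (i k : Fin n) : σ • out i k = out (σ i) (σ k) := rfl

/-- Rank of a gate (inputs `0`, products `1`, sums `2`), used for acyclicity. [folklore] -/
def rank : NaiveMatMulGate n → ℕ
  | inp _ => 0
  | prd _ _ _ => 1
  | out _ _ => 2

/-- Children in the naive circuit. [folklore] -/
def children : NaiveMatMulGate n → Finset (NaiveMatMulGate n)
  | inp _ => ∅
  | prd i j k => {inp (Sum.inl (i, j)), inp (Sum.inr (j, k))}
  | out i k => Finset.univ.image fun j => prd i j k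

/-- Labels in the naive circuit. [folklore] -/
def label (K : Type u) : NaiveMatMulGate n → CircuitLabel K (MatMulVar n)
  | inp x => .var x
  | prd _ _ _ => .mul
  | out _ _ => .add

/-- Children have smaller rank. [folklore] -/
theorem rank_lt_of_mem_children {g h : NaiveMatMulGate n} (hh : h ∈ children g) : rank h < rank g := by
  cases g with
  | inp x => simp [children] at hh
  | prd i j k =>
    simp only [children, Finset.mem_insert, Finset.mem_singleton] at hh
    rcases hh with rfl | rfl <;> simp [rank]
  | out i k =>
    simp only [children, Finset.mem_image, Finset.mem_univ, true_and] at hh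
    obtain ⟨j, rfl⟩ := hh
    simp [rank]

end NaiveMatMulGate

open NaiveMatMulGate in
/-- **The naive `S_n`-symmetric arithmetic circuit for the `n × n` matrix product**: inputs
`A_ij`, `B_jk`, product gates `A_ij × B_jk`, sum gates `Σ_j A_ij B_jk` as outputs `(i, k)`, with
`S_n` relabelling indices everywhere — a `SymmetricArithmeticCircuit` of size `n³ + 3n²`
computing the matrix product (`computesMatrixProduct_naiveMatMulCircuit`). It witnesses that the
notion is inhabited and that the cubic lower bound sought by route `PriceOfSymmetry` would be tight.
[folklore] -/
def naiveMatMulCircuit (K : Type u) (n : ℕ) :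
    SymmetricArithmeticCircuit (Equiv.Perm (Fin n)) K (MatMulVar n) (Fin n × Fin n) (NaiveMatMulGate n) where
  children := NaiveMatMulGate.children
  label := NaiveMatMulGate.label K
  output ik := .out ik.1 ik.2
  wf := Subrelation.wf (fun {h g} (hh : h ∈ NaiveMatMulGate.children g) => rank_lt_of_mem_children hh)
    (InvImage.wf NaiveMatMulGate.rank Nat.lt_wfRel.wf)
  isInput_iff g := by
    cases g with
    | inp x => simp [NaiveMatMulGate.label, NaiveMatMulGate.children]
    | prd i j k => simp [NaiveMatMulGate.label, NaiveMatMulGate.children]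
    | out i k =>
      simp only [NaiveMatMulGate.label, CircuitLabel.not_isInput_add, NaiveMatMulGate.children,
        Finset.image_eq_empty, Finset.univ_eq_empty_iff, false_iff]
      exact fun h => h.elim i
  eq_of_label_eq g g' hg hl := by
    cases g with
    | inp x =>
      cases g' with
      | inp x' => simpa [NaiveMatMulGate.label] using hl
      | prd i j k => simp [NaiveMatMulGate.label] at hl
      | out i k => simp [NaiveMatMulGate.label] at hl
    | prd i j k => simp [NaiveMatMulGate.label] at hg
    | out i k => simp [NaiveMatMulGate.label] at hg
  output_injective := by
    rintro ⟨i, k⟩ ⟨i', k'⟩ h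
    simp only [NaiveMatMulGate.out.injEq] at h
    rw [h.1, h.2]
  children_smul σ g := by
    cases g with
    | inp x => simp [NaiveMatMulGate.children]
    | prd i j k =>
      simp [NaiveMatMulGate.children, Finset.map_insert, Finset.map_singleton]
    | out i k =>
      ext h
      simp only [NaiveMatMulGate.smul_out, NaiveMatMulGate.children, Finset.mem_image,
        Finset.mem_univ, true_and, Finset.mem_map, Equiv.toEmbedding_apply, MulAction.toPerm_apply]
      constructor
      · rintro ⟨j, rfl⟩
        exact ⟨prd i (σ.symm j) k, ⟨σ.symm j, rfl⟩, by simp⟩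
      · rintro ⟨_, ⟨j, rfl⟩, rfl⟩
        exact ⟨σ j, rfl⟩
  label_smul σ g := by cases g <;> rfl
  output_smul σ ik := rfl

/-- The gates of the naive circuit, as a sum type. [folklore] -/
def NaiveMatMulGate.equivSum (n : ℕ) :
    NaiveMatMulGate n ≃ MatMulVar n ⊕ (Fin n × Fin n × Fin n) ⊕ (Fin n × Fin n) where
  toFun
    | .inp x => Sum.inl x
    | .prd i j k => Sum.inr (Sum.inl (i, j, k))
    | .out i k => Sum.inr (Sum.inr (i, k))
  invFun
    | Sum.inl x => .inp x
    | Sum.inr (Sum.inl (i, j, k)) => .prd i j k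
    | Sum.inr (Sum.inr (i, k)) => .out i k
  left_inv g := by cases g <;> rfl
  right_inv s := by rcases s with x | ⟨i, j, k⟩ | ⟨i, k⟩ <;> rfl

/-- The naive circuit has `2n² + n³ + n²` gates. [folklore] -/
theorem size_naiveMatMulCircuit (K : Type u) (n : ℕ) :
    (naiveMatMulCircuit K n).size = 2 * n ^ 2 + n ^ 3 + n ^ 2 := by
  rw [LabelledArithCircuit.size, Fintype.card_congr (NaiveMatMulGate.equivSum n)]
  simp only [Fintype.card_sum, Fintype.card_prod, Fintype.card_fin]
  ring

/-- **The naive circuit computes the matrix product.** [folklore] -/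
theorem computesMatrixProduct_naiveMatMulCircuit (K : Type u) [CommSemiring K] (n : ℕ) :
    (naiveMatMulCircuit K n).ComputesMatrixProduct n := by
  intro ik
  obtain ⟨i, k⟩ := ik
  change (naiveMatMulCircuit K n).eval (.out i k) = matMulEntry K i k
  have hout : (naiveMatMulCircuit K n).label (.out i k) = .add := rfl
  rw [(naiveMatMulCircuit K n).eval_of_label_add hout,
    show (naiveMatMulCircuit K n).children (.out i k) = Finset.univ.image fun j => .prd i j k from rfl,
    Finset.sum_image (fun j _ j' _ h => by simpa using h)]
  unfold matMulEntry
  refine Finset.sum_congr rfl fun j _ => ?_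
  have hprd : (naiveMatMulCircuit K n).label (.prd i j k) = .mul := rfl
  rw [(naiveMatMulCircuit K n).eval_of_label_mul hprd,
    show (naiveMatMulCircuit K n).children (.prd i j k) =
      {NaiveMatMulGate.inp (Sum.inl (i, j)), .inp (Sum.inr (j, k))} from rfl,
    Finset.prod_pair (by simp),
    (naiveMatMulCircuit K n).eval_of_label_var (x := Sum.inl (i, j)) rfl,
    (naiveMatMulCircuit K n).eval_of_label_var (x := Sum.inr (j, k)) rfl]


/-- In the naive circuit the product gate `A_ij × B_jk` is supported by `{i, j, k}` (so every gate
has a support of size `≤ 3`, in the sense of Def. 6.1). [folklore] -/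
theorem isSupport_naiveMatMulCircuit_prd (K : Type u) {n : ℕ} (i j k : Fin n) :
    (naiveMatMulCircuit K n).IsSupport ({i, j, k} : Set (Fin n)) (NaiveMatMulGate.prd i j k) := by
  intro σ hσ
  have hi : σ i = i := by simpa [Equiv.Perm.smul_def] using hσ (a := i) (by simp)
  have hj : σ j = j := by simpa [Equiv.Perm.smul_def] using hσ (a := j) (by simp)
  have hk : σ k = k := by simpa [Equiv.Perm.smul_def] using hσ (a := k) (by simp)
  rw [NaiveMatMulGate.smul_prd, hi, hj, hk]

end MatMul

end Literature.Computability.AlgebraicComplexity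

end
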